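import Literature.NumberTheory.EllipticCurves.OrdinaryReductionTorsionLineProofs
import Literature.NumberTheory.GaloisRepresentations.FundamentalCharacterCyclotomicProofs
import HarnessLib

/-!
# The inertia shape `(ψ₁ *; 0 1)` of `ρ̄_{E,p}|I_p` at a good ordinary prime of `E/ℚ`
# (Serre 1972, §1.11 Cor.; Serre 1987, (2.8.2) and (4.1.11))

`Proofs` file (theorems only: no definition, no named fact), topic `NumberTheory/EllipticCurves`;
sequel of `OrdinaryReductionTorsionLineProofs` (Serre's line `X_p` and the triangular form of
`ρ̄_{E,p}` on inertia) and of `FundamentalCharacterCyclotomicProofs` (`ψ₁ = χ̄_p` on inertia for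
`e = f = 1`).

* `hasLevelOneInertiaShape_restrictField_of_not_dvd_frobeniusTraceAt` — over `K = ℚ` (`e = 1`):
  for an elliptic curve `E/ℚ` with good ORDINARY reduction at the place `v` over `p`, a framing
  `ρ̄` of `E[p]` (`W.IsTorsionGaloisRep p ρ̄`), every residue embedding `ι` and every
  `j : 𝔽_p → k`, the local representation `(ρ̄ ⊗_j k)|Γ_{ℚ_v}`
  (`FramedGaloisRep.restrictField (v.adicCompletion ℚ) (ρ̄ ⊗_j k)`) has the level-one inertia
  shape `(ψ₁ *; 0 1)` = `HasLevelOneInertiaShape ι p _ 1 0` of Serre's recipe (item C15/C16).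

## References

* [SerreInventiones1972] J.-P. Serre, Invent. Math. 15 (1972) 259–331, §1.11, Prop. 11, Cor.;
  §1.8, Cor.
* [Serre1987] J.-P. Serre, Duke Math. J. 54 (1987), §2.8, (2.8.2) and Prop. 3; §4.1 (4.1.11).
-/

noncomputable section

open scoped Classical NNReal NumberField AddSubgroup
open NumberField IsDedekindDomain Polynomial

/-! ## §E Over `ℚ`: the level-one inertia shape `(ψ₁ *; 0 1)` of `ρ̄_{E,p}|I_p` (Serre's recipe) -/

namespace WeierstrassCurve

open Literature.NumberTheory.GaloisRepresentations Literature.NumberTheory.EllipticCurves Field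
  Literature.NumberTheory.GaloisRepresentations.ModPGaloisRep ValuativeRel
  Literature.NumberTheory.GaloisRepresentations.IsNonarchimedeanLocalField

/-- **Serre 1987, (4.1.11)/§2.8 (2.8.2) at a good ordinary prime: `ρ̄_{E,p}|I_p ≃ (χ *; 0 1)`.**  Let
`E/ℚ` be an elliptic curve, `p` a prime, `v` the place of `ℚ` over `p`, and suppose `E` has good
ORDINARY reduction at `v` (`p ∤ a_p`).  Let `ρ̄ : Γ_ℚ → GL₂(𝔽_p)` be a framing of `E[p]`
(`W.IsTorsionGaloisRep p ρ̄`), `j : 𝔽_p → k` a (continuous) ring homomorphism into a topological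
field and `ι` a residue embedding for `ℚ_v = v.adicCompletion ℚ`.  Then the local representation
`(ρ̄ ⊗_j k)|Γ_{ℚ_v}` has the level-one inertia shape `(ψ₁ *; 0 1)` of Serre's recipe, with respect
to the uniformiser `p` of `ℚ_v` (`HasLevelOneInertiaShape ι p _ 1 0`): by
`exists_line_geomTorsion_of_not_dvd_frobeniusTraceAt` and `IsTorsionGaloisRep.exists_conj_eq_of_line`
the inertia group is upper triangular with diagonal `(det, 1) = (χ̄_p, 1)` (the Weil pairing,
`det_eq_modPCyclotomicCharacter_of_isTorsionGaloisRep_holds`; restriction,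
`modPCyclotomicCharacterZMod_absGaloisRestrict`), and `χ̄_p = ψ₁` on `I_{ℚ_v}` (`e = 1`,
`coe_fundamentalCharacter_one_eq_modPCyclotomicCharacter`).  The hypotheses
`Irreducible (p : 𝒪[ℚ_v])` and `#𝓀[ℚ_v] = p` hold (`SerreConjectureProofs`) and are taken as
arguments only to name the uniformiser in the conclusion.
[cite: SerreInventiones1972, §1.11 Prop. 11 and Cor.; §1.8 Cor.] [cite: Serre1987, §2.8 (2.8.2); §4.1 (4.1.11)] -/
theorem hasLevelOneInertiaShape_restrictField_of_not_dvd_frobeniusTraceAt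
    (W : WeierstrassCurve ℚ) [W.IsElliptic] (p : ℕ) [hp : Fact p.Prime]
    (v : HeightOneSpectrum (𝓞 ℚ)) (hpv : (p : 𝓞 ℚ) ∈ v.asIdeal) (hgood : W.HasGoodReductionAt v)
    (hord : ¬ ((p : ℤ) ∣ W.frobeniusTraceAt v))
    {ρ : ModPGaloisRep ℚ (ZMod p) 2} (hρ : W.IsTorsionGaloisRep p ρ)
    {k : Type} [Field k] [TopologicalSpace k] [IsTopologicalRing k] (j : ZMod p →+* k)
    (hj : Continuous j)
    (hirr : Irreducible ((p : ℕ) : 𝒪[v.adicCompletion ℚ]))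
    (hq : residueFieldCard (v.adicCompletion ℚ) = p)
    (ι : absIntegers 𝒪[v.adicCompletion ℚ] (v.adicCompletion ℚ) ⧸
      absMaximalIdeal (v.adicCompletion ℚ) →+* k) :
    ModPGaloisRep.HasLevelOneInertiaShape
      (FramedGaloisRep.restrictField (v.adicCompletion ℚ) (FramedRep.baseChange j hj ρ) :
        ModPGaloisRep (v.adicCompletion ℚ) k 2) ι ((p : ℕ) : 𝒪[v.adicCompletion ℚ]) hirr 1 0 := by
  haveI : NeZero ((p : ℕ) : ℚ) := ⟨Nat.cast_ne_zero.mpr hp.out.ne_zero⟩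
  haveI : NeZero ((p : ℕ) : v.adicCompletion ℚ) := neZero_natCast_of_irreducible hirr
  set F := v.adicCompletion ℚ with hF
  obtain ⟨Λ, hΛ, hcard, hstab, hquot⟩ :=
    exists_line_geomTorsion_of_not_dvd_frobeniusTraceAt W p v hpv hgood hord
  obtain ⟨Q, hQ⟩ := IsTorsionGaloisRep.exists_conj_eq_of_line hρ hΛ hcard
    (fun τ hτ x hx ↦ hstab τ x hx) hquot
  refine ⟨Matrix.GeneralLinearGroup.map j Q⁻¹, fun σ ↦ ?_⟩
  obtain ⟨c, hc⟩ := hQ σ σ.2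
  refine ⟨j c, ?_⟩
  -- the conjugated matrix is the entrywise image of `Q⁻¹ ρ̄(res σ) Q`
  have hmat : ((Matrix.GeneralLinearGroup.map j Q⁻¹ *
        (FramedGaloisRep.restrictField (v.adicCompletion ℚ) (FramedRep.baseChange j hj ρ) :
          ModPGaloisRep (v.adicCompletion ℚ) k 2) (σ : absoluteGaloisGroup (v.adicCompletion ℚ)) *
        (Matrix.GeneralLinearGroup.map j Q⁻¹)⁻¹ : GL (Fin 2) k) : Matrix (Fin 2) (Fin 2) k) =
      (((Q⁻¹ * ρ (absGaloisRestrict ℚ (v.adicCompletion ℚ) σ) * Q : GL (Fin 2) (ZMod p)) :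
        Matrix (Fin 2) (Fin 2) (ZMod p))).map j := by
    rw [FramedGaloisRep.restrictField_apply, Matrix.GeneralLinearGroup.coe_mul,
      Matrix.GeneralLinearGroup.coe_mul, FramedRep.coe_baseChange_apply, map_inv, inv_inv,
      Matrix.GeneralLinearGroup.coe_mul, Matrix.GeneralLinearGroup.coe_mul, Matrix.map_mul,
      Matrix.map_mul]
    rfl
  have hmap : ∀ (a b c d : ZMod p), (!![a, b; c, d] : Matrix (Fin 2) (Fin 2) (ZMod p)).map j =
      !![j a, j b; j c, j d] := fun a b c d ↦ by
    ext i i'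
    fin_cases i <;> fin_cases i' <;> rfl
  rw [hmat, hc, hmap]
  -- entries: `j (det ρ̄(res σ)) = ψ₁(σ)`, `j 0 = 0`, `j 1 = 1`
  have hdet : Matrix.GeneralLinearGroup.det (ρ (absGaloisRestrict ℚ (v.adicCompletion ℚ) σ)) =
      modPCyclotomicCharacterZMod (v.adicCompletion ℚ) p σ := by
    rw [det_eq_modPCyclotomicCharacter_of_isTorsionGaloisRep_holds W p ρ hρ,
      modPCyclotomicCharacterZMod_absGaloisRestrict]
  have hψ : ((fundamentalCharacter (v.adicCompletion ℚ) 1 ι ((p : ℕ) : 𝒪[v.adicCompletion ℚ]) hirr σ :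
      kˣ) : k) = j (modPCyclotomicCharacterZMod (v.adicCompletion ℚ) p σ : ZMod p) := by
    rw [coe_fundamentalCharacter_one_eq_modPCyclotomicCharacter hirr hq ι j σ,
      coe_modPCyclotomicCharacter_apply]
  rw [pow_one, pow_zero, Units.val_one, hψ, hdet, map_zero, map_one]

end WeierstrassCurve
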